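import Summits.QuantumAdvantage.AdviceFreeQNC0.BlockComb37Fam
import HarnessLib

/-!
# Cell qa-qnc0 — P-37c (c2)/(c3): the BLOCK-COMB THEOREM and (G₁) for every gate (2/4)

Cell qa-qnc0, crux stmt-QuantumAdvantage-22907.  AUTHORED AND PROVED BY THE PLANNER qa-qnc0-p1 gen 37 (P-37c (c2)+(c3), INBOX P1-37c 14:53Z, evidence #60 on stmt-22907, file `HOME/qa-qnc0-p1/exp37/BlockComb37.lean`, 1082 lines, sha db0f1086629d090a, rc 0 / 0 sorries); landed verbatim by qn-prover-3 g21 as a four-way split: `BlockComb37Fam` (§§0–3: typed targets `gateSum`/`EveryGateHard`/`GatesHardConst`, block algebra, sub-families, averaging identities + quarter lemma) → `BlockComb37Data` (§§4–5: `CombData`, local bit flips, the count on a background with many good blocks) → `BlockComb37` (§§6–8: few backgrounds have few good blocks, ★ `blockComb_le` THE BLOCK-COMB THEOREM, small-block bit calculus) → `BlockCombGate37` (§§9–10: the comb data of one gate, ★ `everyGateHard : EveryGateHard`).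
-/

noncomputable section

open Classical

namespace Summit.QuantumAdvantage.AdviceFreeQNC0

open Finset
open Literature.Computability.MetaComplexity Literature.Computability.MetaComplexity.Smolensky
open F4 AffBells22 Subcube

namespace BlockFibre37

variable {n m : ℕ}

/-! ### 4. Comb data and local bit flips -/

/-- flip the walk bit at position `p` (identity if `p ≥ n`). -/
def flipN (p : ℕ) (u : Fin n → Bool) : Fin n → Bool := fun i => if i.val = p then !u i else u i

/-- conditional flip. -/
def flipB (b : Bool) (p : ℕ) (u : Fin n → Bool) : Fin n → Bool := if b = true then flipN p u else u

/-- `flipN p` is an involution. -/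
theorem flipN_flipN (p : ℕ) (u : Fin n → Bool) : flipN p (flipN p u) = u := by
  funext i; unfold flipN; by_cases h : i.val = p <;> simp [h]

/-- Single-bit flips commute. -/
theorem flipN_comm (p q : ℕ) (u : Fin n → Bool) : flipN p (flipN q u) = flipN q (flipN p u) := by
  funext i; simp only [flipN]; split_ifs <;> simp

/-- `flipN p` fixes coordinates other than `p`. -/
theorem flipN_apply_of_ne (p : ℕ) (u : Fin n → Bool) {i : Fin n} (h : i.val ≠ p) : flipN p u i = u i := by
  unfold flipN; rw [if_neg h]

/-- The conditional flip `flipB b p` is an involution. -/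
theorem flipB_flipB (b : Bool) (p : ℕ) (u : Fin n → Bool) : flipB b p (flipB b p u) = u := by
  unfold flipB; cases b <;> simp [flipN_flipN]

/-- Conditional flips commute. -/
theorem flipB_comm (b b' : Bool) (p q : ℕ) (u : Fin n → Bool) : flipB b p (flipB b' q u) = flipB b' q (flipB b p u) := by
  unfold flipB; cases b <;> cases b' <;> simp [flipN_comm]

/-- `flipB b p` fixes coordinates other than `p`. -/
theorem flipB_apply_of_ne (b : Bool) (p : ℕ) (u : Fin n → Bool) {i : Fin n} (h : i.val ≠ p) : flipB b p u i = u i := by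
  unfold flipB; cases b <;> simp [flipN_apply_of_ne p u h]

/-- The extended input after `flipN p`: negated exactly at `p < n`. -/
theorem uExt_flipN (p : ℕ) (u : Fin n → Bool) (i : ℕ) :
    uExt (flipN p u) i = if (i = p ∧ i < n) then !uExt u i else uExt u i := by
  unfold uExt flipN
  by_cases hin : i < n
  · rw [dif_pos hin, dif_pos hin]
    simp only
    by_cases hip : i = p
    · rw [if_pos hip, if_pos ⟨hip, hin⟩]
    · rw [if_neg hip, if_neg fun h => hip h.1]
  · rw [dif_neg hin, dif_neg hin, if_neg fun h => hin h.2]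

/-- **comb data**: blocks with disjoint neighbourhoods, a local goodness predicate invariant under the own-block
complement and implying admissibility, and two resampling positions reaching a good point from everywhere. -/
structure CombData (n K : ℕ) where
  fam : BlockFam n K
  lo : Fin K → ℕ
  hi : Fin K → ℕ
  lo_le : ∀ k, lo k + 1 ≤ fam.st k
  le_hi : ∀ k, fam.st k + fam.len k ≤ hi k
  hi_lt : ∀ k, hi k < n
  disj : ∀ k k' : Fin K, k < k' → hi k < lo k'
  Good : Fin K → (Fin n → Bool) → Prop
  good_local : ∀ k (u u' : Fin n → Bool), (∀ i : Fin n, lo k ≤ i.val → i.val ≤ hi k → u i = u' i) → Good k u → Good k u'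
  good_cpl : ∀ k u, Good k u → Good k (cpl fam k u)
  good_adm : ∀ k u, Good k u → Admissible fam u k
  pc : Fin K → ℕ
  pd : Fin K → ℕ
  pc_mem : ∀ k, lo k ≤ pc k ∧ pc k ≤ hi k
  pd_mem : ∀ k, lo k ≤ pd k ∧ pd k ≤ hi k
  abundant : ∀ k u, ∃ s t : Bool, Good k (flipB t (pd k) (flipB s (pc k) u))

variable {K : ℕ}

/-- within the neighbourhood of `k`, only block `k` has bits. -/
theorem inBlock_nbhd (cd : CombData n K) {k j : Fin K} {i : Fin n} (hlo : cd.lo k ≤ i.val) (hhi : i.val ≤ cd.hi k)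
    (h : InBlock cd.fam j i) : j = k := by
  unfold InBlock at h
  by_contra hne
  rcases lt_or_gt_of_ne hne with hlt | hlt
  · have h1 := cd.disj j k hlt; have h2 := cd.le_hi j; omega
  · have h1 := cd.disj k j hlt; have h2 := cd.lo_le j; omega

/-- on the neighbourhood of `k`, the fibre point is `u` (if `v k = false`) … -/
theorem blockExt_nbhd_false (cd : CombData n K) (u : Fin n → Bool) {v : Fin K → Bool} {k : Fin K} (hv : v k = false)
    (i : Fin n) (hlo : cd.lo k ≤ i.val) (hhi : i.val ≤ cd.hi k) : blockExt cd.fam u v i = u i := by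
  by_cases h : InBlock cd.fam k i
  · rw [blockExt_of_inBlock cd.fam u v h, hv]; simp
  · refine blockExt_of_not_inBlock cd.fam u v fun j hj => ?_
    have := inBlock_nbhd cd hlo hhi hj
    subst this; exact h hj

/-- … or `cpl k u` (if `v k = true`). -/
theorem blockExt_nbhd_true (cd : CombData n K) (u : Fin n → Bool) {v : Fin K → Bool} {k : Fin K} (hv : v k = true)
    (i : Fin n) (hlo : cd.lo k ≤ i.val) (hhi : i.val ≤ cd.hi k) : blockExt cd.fam u v i = cpl cd.fam k u i := by
  by_cases h : InBlock cd.fam k i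
  · rw [blockExt_of_inBlock cd.fam u v h, hv, cpl_of_inBlock cd.fam u h]; simp
  · rw [cpl_of_not_inBlock cd.fam u h]
    refine blockExt_of_not_inBlock cd.fam u v fun j hj => ?_
    have := inBlock_nbhd cd hlo hhi hj
    subst this; exact h hj

/-- **goodness is constant along fibres.** -/
theorem good_blockExt_iff (cd : CombData n K) (k : Fin K) (u : Fin n → Bool) (v : Fin K → Bool) :
    cd.Good k (blockExt cd.fam u v) ↔ cd.Good k u := by
  cases hv : v k
  · constructor
    · exact cd.good_local k _ _ fun i hlo hhi => blockExt_nbhd_false cd u hv i hlo hhi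
    · exact cd.good_local k _ _ fun i hlo hhi => (blockExt_nbhd_false cd u hv i hlo hhi).symm
  · constructor
    · intro h
      have h1 : cd.Good k (cpl cd.fam k u) :=
        cd.good_local k _ _ (fun i hlo hhi => blockExt_nbhd_true cd u hv i hlo hhi) h
      have h2 := cd.good_cpl k _ h1
      rwa [cpl_cpl] at h2
    · intro h
      exact cd.good_local k _ _ (fun i hlo hhi => (blockExt_nbhd_true cd u hv i hlo hhi).symm) (cd.good_cpl k u h)

/-- the set of good blocks of an input. -/
def GoodSet (cd : CombData n K) (u : Fin n → Bool) : Finset (Fin K) := univ.filter fun k => cd.Good k u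

/-- The set of good blocks is unchanged along the fibre (goodness is invariant under own-block complements and local). -/
theorem goodSet_blockExt (cd : CombData n K) (u : Fin n → Bool) (v : Fin K → Bool) :
    GoodSet cd (blockExt cd.fam u v) = GoodSet cd u := by
  unfold GoodSet
  exact filter_congr fun k _ => good_blockExt_iff cd k u v

/-- **a selector blind to good block complements is constant along good coordinates of the fibre.** -/
theorem sigma_const (cd : CombData n K) {T : Type} (σ : (Fin n → Bool) → T)
    (hσ : ∀ (u : Fin n → Bool) (k : Fin K), cd.Good k u → σ (cpl cd.fam k u) = σ u) (u : Fin n → Bool) :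
    ∀ (N : ℕ) (v : Fin K → Bool), (univ.filter fun k => v k = true).card ≤ N → (∀ k, v k = true → cd.Good k u) →
      σ (blockExt cd.fam u v) = σ u := by
  intro N
  induction N with
  | zero =>
    intro v hv _
    have h0 : v = fun _ => false := by
      funext k
      by_contra hk
      have hk' : v k = true := by cases h : v k; exact absurd h hk; rfl
      have : k ∈ (univ.filter fun k => v k = true) := mem_filter.2 ⟨mem_univ _, hk'⟩
      rw [Nat.le_zero, card_eq_zero] at hv
      rw [hv] at this; exact absurd this (by simp)
    rw [h0, blockExt_zero]
  | succ N ih =>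
    intro v hv hgood
    by_cases hex : ∃ k, v k = true
    · obtain ⟨k₀, hk₀⟩ := hex
      set v' := Function.update v k₀ false with hv'
      have hv'k : v' k₀ = false := by rw [hv', Function.update_self]
      have hvv : v = Function.update v' k₀ true := by
        funext k; by_cases hk : k = k₀
        · subst hk; rw [Function.update_self, hk₀]
        · rw [Function.update_of_ne hk, hv', Function.update_of_ne hk]
      have hcard : (univ.filter fun k => v' k = true).card ≤ N := by
        have hsub : (univ.filter fun k => v' k = true) ⊆ (univ.filter fun k => v k = true).erase k₀ := by
          intro k hk
          rw [mem_filter] at hk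
          rw [mem_erase, mem_filter]
          by_cases hkk : k = k₀
          · subst hkk; rw [hv'k] at hk; exact absurd hk.2 (by simp)
          · rw [hv', Function.update_of_ne hkk] at hk; exact ⟨hkk, mem_univ _, hk.2⟩
        have h1 := card_le_card hsub
        have h2 : ((univ.filter fun k => v k = true).erase k₀).card + 1 = (univ.filter fun k => v k = true).card :=
          card_erase_add_one (mem_filter.2 ⟨mem_univ _, hk₀⟩)
        omega
      have hgood' : ∀ k, v' k = true → cd.Good k u := by
        intro k hk
        by_cases hkk : k = k₀
        · subst hkk; exact hgood k hk₀
        · rw [hv', Function.update_of_ne hkk] at hk; exact hgood k hk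
      rw [hvv, blockExt_update cd.fam u v' k₀ hv'k, hσ _ k₀ ((good_blockExt_iff cd k₀ u v').2 (hgood k₀ hk₀))]
      exact ih v' hcard hgood'
    · have h0 : v = fun _ => false := by
        funext k; cases h : v k; rfl; exact absurd ⟨k, h⟩ hex
      rw [h0, blockExt_zero]

/-! ### 5. (B)+(C)+(D): the count on a background with many good blocks -/

/-- **N(a) ≤ (1 − c₀)·2^K** when the background has `s > t ≥ m₀, 9r²` good blocks. -/
theorem Na_le (cd : CombData n K) {c₀ : ℝ} {m₀ : ℕ}
    (hcore : ∀ m ≥ m₀, ∀ D : ℕ, D ≤ Nat.sqrt m →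
      ∀ f : (Fin m → Bool) → F4, f ∈ fullSpan m D → c₀ * (2 : ℝ) ^ m ≤ ((failSetOf f).card : ℝ))
    {r : ℕ} {T : Type} (σ : (Fin n → Bool) → T) (G : T → Fin (n + 1) → (Fin n → Bool) → Bool)
    (hσ : ∀ (u : Fin n → Bool) (k : Fin K), cd.Good k u → σ (cpl cd.fam k u) = σ u)
    (hloc : ∀ t, WindowLocal r (G t)) (c : ℕ) (a : Fin n → Bool)
    (hm : m₀ ≤ (GoodSet cd a).card) (hr : (2 * r + 1) ^ 2 ≤ (GoodSet cd a).card) :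
    ((univ.filter fun v : Fin K → Bool =>
        ringWinU c (fun g u => G (σ u) g u) (blockExt cd.fam a v) = true).card : ℝ) ≤ (1 - c₀) * (2 : ℝ) ^ K := by
  set S := GoodSet cd a with hS
  set s := S.card with hs
  set y : Fin (n + 1) → (Fin n → Bool) → Bool := fun g u => G (σ u) g u with hy
  -- (D) the sub-family fibre bound at every point of the full fibre
  have hD : ∀ v : Fin K → Bool,
      ((univ.filter fun w : Fin s → Bool => ringWinU c y (blockExt (sub cd.fam S) (blockExt cd.fam a v) w) = true).card
        : ℝ) ≤ (1 - c₀) * (2 : ℝ) ^ s := by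
    intro v
    set u := blockExt cd.fam a v with hu
    have hgood : ∀ k ∈ S, cd.Good k u := by
      intro k hk
      rw [hS, GoodSet, mem_filter] at hk
      rw [hu]; exact (good_blockExt_iff cd k a v).2 hk.2
    have hadm : ∀ j, Admissible (sub cd.fam S) u j := by
      intro j
      rw [admissible_sub]
      exact cd.good_adm _ _ (hgood _ (Finset.orderEmbOfFin_mem S rfl j))
    have hconst : ∀ w : Fin s → Bool, σ (blockExt (sub cd.fam S) u w) = σ u := by
      intro w
      rw [blockExt_sub]
      refine sigma_const cd σ hσ u K (iota S w) ?_ (fun k hk => hgood k (iota_mem hk))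
      calc (univ.filter fun k => iota S w k = true).card ≤ (univ : Finset (Fin K)).card := card_le_card (filter_subset _ _)
        _ = K := by rw [card_univ, Fintype.card_fin]
    have hdeg : ∀ g, HasDeg (fun w => y g (blockExt (sub cd.fam S) u w)) (2 * r) := by
      intro g
      have e : (fun w => y g (blockExt (sub cd.fam S) u w)) = fun w => G (σ u) g (blockExt (sub cd.fam S) u w) := by
        funext w; rw [hy]; simp only; rw [hconst w]
      rw [e]
      exact hasDeg_comp_blockExt (sub cd.fam S) u (hasDeg_of_windowLocal (hloc (σ u)) g)
    have hsq : 2 * r + 1 ≤ Nat.sqrt s := Nat.le_sqrt'.2 hr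
    exact card_win_blockExt_le hcore (sub cd.fam S) hm u hadm hsq c y hdeg
  -- (B) second averaging + (C) re-basing
  have hB := avg_identity (PhiS S) (PhiS_invol S) (fun v : Fin K → Bool => ringWinU c y (blockExt cd.fam a v) = true)
  have hB' : (2 : ℝ) ^ s * ((univ.filter fun v : Fin K → Bool => ringWinU c y (blockExt cd.fam a v) = true).card : ℝ)
      = ∑ v : Fin K → Bool, ((univ.filter fun w : Fin s → Bool =>
          ringWinU c y (blockExt (sub cd.fam S) (blockExt cd.fam a v) w) = true).card : ℝ) := by
    have e : ∀ v : Fin K → Bool, (univ.filter fun w : Fin s → Bool => ringWinU c y (blockExt cd.fam a (PhiS S w v)) = true)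
        = univ.filter fun w : Fin s → Bool => ringWinU c y (blockExt (sub cd.fam S) (blockExt cd.fam a v) w) = true := by
      intro v; refine filter_congr fun w _ => ?_; rw [blockExt_PhiS]
    have hB2 := hB
    rw [sum_congr rfl fun v _ => congrArg Finset.card (e v)] at hB2
    exact_mod_cast hB2
  have hsum : ∑ v : Fin K → Bool, ((univ.filter fun w : Fin s → Bool =>
      ringWinU c y (blockExt (sub cd.fam S) (blockExt cd.fam a v) w) = true).card : ℝ)
      ≤ (2 : ℝ) ^ K * ((1 - c₀) * (2 : ℝ) ^ s) := by
    have h := Finset.sum_le_card_nsmul (univ : Finset (Fin K → Bool)) _ ((1 - c₀) * (2 : ℝ) ^ s) (fun v _ => hD v)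
    rw [nsmul_eq_mul, card_univ, Fintype.card_fun, Fintype.card_bool, Fintype.card_fin] at h
    exact_mod_cast h
  have hpos : (0 : ℝ) < (2 : ℝ) ^ s := by positivity
  have key : (2 : ℝ) ^ s * ((univ.filter fun v : Fin K → Bool => ringWinU c y (blockExt cd.fam a v) = true).card : ℝ)
      ≤ (2 : ℝ) ^ s * ((1 - c₀) * (2 : ℝ) ^ K) := by rw [hB']; nlinarith
  exact le_of_mul_le_mul_left key hpos

end BlockFibre37

end Summit.QuantumAdvantage.AdviceFreeQNC0
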